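import Literature.NumberTheory.Automorphic.SmoothInduction
import Literature.NumberTheory.Automorphic.ParabolicInductionQuotientProofs
import Mathlib.Topology.Algebra.OpenSubgroup
import HarnessLib

/-!
# Big-cell data and the standard vectors of an induced representation

Generic smooth representation theory (no `GL_n`), first half of the abstract form of "parabolic
induction carries irreducible (finitely generated) representations to finitely generated ones"
(Bernstein–Zelevinsky 1976, §3.13 (c) for `GL_n`; Bernstein 1992 (Harvard notes), Ch. III;
Renard 2010, VI.1.5); the generation argument itself is the sibling file `SmoothInductionCyclic`.
We isolate the group-theoretic input as a **big-cell datum** for a subgroup `P ≤ G` of a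
topological group (`Representation.BigCellDatum`):

* an "opposite radical" `Ū`, closed, with `P ∩ Ū = 1` (so `(p, u) ↦ p u` is injective onto the
  *big cell* `P Ū`, `BigCellDatum.eq_of_mul_eq`) and a subgroup `M ≤ P` normalising `Ū`;
* a compact subgroup `K₀` with `G = P K₀` (Iwasawa decomposition) and a neighbourhood basis of `1`
  of compact open subgroups `K j`, normalised by `K₀`, with the two-factor Iwahori factorisation
  `K j ⊆ (P ∩ K j) (Ū ∩ K j)`;
* a set `Z ⊆ M` of "contracting" elements: for all `j, j'` and `m ∈ M` some `t ∈ Z` has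
  `(m t) (Ū ∩ K j) (m t)⁻¹ ⊆ K j'`.

For `G = GL_n(F)` and `P = P_c` these are: `Ū = U_c⁻`, `M` the block diagonal Levi,
`K₀ = GL_n(𝒪)`, `K j` the principal congruence subgroups, `Z` the block-scalar powers of a
uniformiser. Given a datum and a representation `τ` of `P` on `W` we define

* `Representation.IsBigCell 𝒟 τ f`: the vector `f ∈ Ind_P^G τ` vanishes off `P Ū`; such vectors
  are determined by their values on `Ū` (`IsBigCell.ext`), and big-cell support is preserved by
  right translations from `Ū` and `M` (`IsBigCell.apply_Ubar`, `IsBigCell.apply_M`, with the value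
  formulas `toFun_apply_Ubar`, `toFun_apply_M`) and by linear combinations;
* `Representation.fixedByLevel 𝒟 τ j = W^{τ(P ∩ K j)}` and the **standard vectors**
  `Representation.stdFun 𝒟 τ j w` (`w ∈ W^{τ(P ∩ K j)}`): the function supported on `P (Ū ∩ K j)`
  with `φ(p u) = τ(p) w` (Bernstein–Zelevinsky 1976, §2.21–2.25), which is `K j`-fixed
  (`stdFun_mem_fixedPoints`, by the Iwahori factorisation), big-cell supported, and equal to
  `1_{Ū ∩ K j} ⊗ w` on `Ū` (`toFun_stdFun_of_mem_Ubar`).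

Theorems, one `structure` of hypotheses and the definitions `IsBigCell`, `fixedByLevel`,
`stdFunAux`/`stdFun`; no named facts.

## References

* I. N. Bernstein, A. V. Zelevinsky, *Representations of the group `GL(n, F)` where `F` is a
  non-archimedean local field*, Russian Math. Surveys 31:3 (1976), §2.21–2.25, §3.13.
* J. Bernstein, *Representations of `p`-adic groups* (Harvard lectures, notes by K. Rumelhart,
  1992), Ch. II–III.
* W. Casselman, *Introduction to the theory of admissible representations of `p`-adic reductive
  groups* (1995 notes), §1.4 (Iwahori factorisation), §3.
-/

noncomputable section

open scoped Pointwise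
open Topology

namespace Representation

/-! ### The datum -/

section Datum

variable {G : Type*} [Group G] [TopologicalSpace G]

/-- A **big-cell datum** for a subgroup `P` of a topological group `G`: an opposite radical `Ū`
meeting `P` trivially, a subgroup `M ≤ P` normalising `Ū`, a compact set `K₀` with `G = P K₀`, a
neighbourhood basis of compact open subgroups `K j` normalised by `K₀` with the two-factor
Iwahori factorisation `K j ⊆ (P ∩ K j)(Ū ∩ K j)`, and a set `Z ⊆ M` of contracting elements.
These are the group-theoretic facts about `(GL_n(F), P_c)` consumed by the proof that parabolic
induction preserves finite generation (Bernstein–Zelevinsky 1976, §3.13; Casselman 1995, §1.4: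
Iwasawa decomposition, Iwahori factorisation, contraction by dominant central elements).
[folklore] -/
structure BigCellDatum (P : Subgroup G) where
  /-- The opposite radical `Ū`. -/
  Ubar : Subgroup G
  /-- `Ū` is closed. -/
  isClosed_Ubar : IsClosed (Ubar : Set G)
  /-- `P ∩ Ū = 1`. -/
  eq_one_of_mem : ∀ g ∈ P, g ∈ Ubar → g = 1
  /-- The Levi-type subgroup `M ≤ P`. -/
  M : Subgroup G
  /-- `M ≤ P`. -/
  M_le : M ≤ P
  /-- `M` normalises `Ū`. -/
  conj_mem_Ubar : ∀ m ∈ M, ∀ u ∈ Ubar, m * u * m⁻¹ ∈ Ubar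
  /-- The compact subgroup `K₀` of the Iwasawa decomposition. -/
  K₀ : Subgroup G
  /-- `K₀` is compact. -/
  isCompact_K₀ : IsCompact (K₀ : Set G)
  /-- Iwasawa decomposition `G = P K₀`. -/
  exists_mul_eq : ∀ g : G, ∃ p ∈ P, ∃ s ∈ K₀, g = p * s
  /-- The compact open subgroups `K j`. -/
  K : ℕ → Subgroup G
  /-- Each `K j` is open. -/
  isOpen_K : ∀ j, IsOpen (K j : Set G)
  /-- Each `K j` is compact. -/
  isCompact_K : ∀ j, IsCompact (K j : Set G)
  /-- The `K j` form a neighbourhood basis of `1`. -/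
  exists_K_subset : ∀ U ∈ 𝓝 (1 : G), ∃ j, (K j : Set G) ⊆ U
  /-- `K₀` normalises each `K j`. -/
  conj_mem_K : ∀ j, ∀ s ∈ K₀, ∀ x ∈ K j, s * x * s⁻¹ ∈ K j
  /-- Two-factor Iwahori factorisation `K j ⊆ (P ∩ K j) (Ū ∩ K j)`. -/
  exists_factor : ∀ j, ∀ x ∈ K j, ∃ p ∈ P, p ∈ K j ∧ ∃ u ∈ Ubar, u ∈ K j ∧ x = p * u
  /-- The contracting elements. -/
  Z : Set G
  /-- `Z ⊆ M`. -/
  Z_subset : Z ⊆ M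
  /-- Contraction: `(m t)(Ū ∩ K j)(m t)⁻¹ ⊆ K j'` for some `t ∈ Z`. -/
  exists_contract : ∀ (j j' : ℕ) (m : G), m ∈ M →
    ∃ t ∈ Z, ∀ u ∈ Ubar, u ∈ K j → m * t * u * (m * t)⁻¹ ∈ K j'

end Datum

/-! ### Functions on the big cell -/

section BigCell

variable {k G W : Type*} [CommRing k] [Group G] [TopologicalSpace G]
  [AddCommGroup W] [Module k W] {P : Subgroup G} (𝒟 : BigCellDatum P) (τ : Representation k P W)

/-- Uniqueness of the decomposition on the big cell: `p u = p' u'` forces `p = p'`, `u = u'`. [folklore] -/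
theorem BigCellDatum.eq_of_mul_eq {p p' u u' : G} (hp : p ∈ P) (hp' : p' ∈ P) (hu : u ∈ 𝒟.Ubar)
    (hu' : u' ∈ 𝒟.Ubar) (h : p * u = p' * u') : p = p' ∧ u = u' := by
  have h1 : p'⁻¹ * p = u' * u⁻¹ := by
    rw [inv_mul_eq_iff_eq_mul, ← mul_assoc, eq_mul_inv_iff_mul_eq, h]
  have hP : p'⁻¹ * p ∈ P := P.mul_mem (P.inv_mem hp') hp
  have hU : p'⁻¹ * p ∈ 𝒟.Ubar := h1 ▸ 𝒟.Ubar.mul_mem hu' (𝒟.Ubar.inv_mem hu)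
  have h2 : p'⁻¹ * p = 1 := 𝒟.eq_one_of_mem _ hP hU
  have hpp : p = p' := by
    rw [inv_mul_eq_one] at h2
    exact h2.symm
  refine ⟨hpp, ?_⟩
  rw [hpp] at h
  exact mul_left_cancel h

variable [SeparatelyContinuousMul G]

/-- A vector of `Ind_P^G τ` is **supported on the big cell** if it vanishes off `P Ū`. [folklore] -/
def IsBigCell (f : SmoothInd P τ) : Prop := ∀ x, f.toFun x ≠ 0 → x ∈ (P : Set G) * (𝒟.Ubar : Set G)

/-- Two big-cell-supported vectors of `Ind_P^G τ` with the same values on `Ū` are equal. [folklore] -/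
theorem IsBigCell.ext {f g : SmoothInd P τ} (hf : IsBigCell 𝒟 τ f) (hg : IsBigCell 𝒟 τ g)
    (h : ∀ u ∈ 𝒟.Ubar, f.toFun u = g.toFun u) : f = g := by
  refine SmoothInd.ext (funext fun x => ?_)
  by_cases hx : x ∈ (P : Set G) * (𝒟.Ubar : Set G)
  · obtain ⟨p, hp, u, hu, rfl⟩ := Set.mem_mul.1 hx
    rw [show p * u = ((⟨p, hp⟩ : P) : G) * u from rfl, f.toFun_subgroup_mul, g.toFun_subgroup_mul,
      h u hu]
  · have hf0 : f.toFun x = 0 := by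
      by_contra h0
      exact hx (hf x h0)
    have hg0 : g.toFun x = 0 := by
      by_contra h0
      exact hx (hg x h0)
    rw [hf0, hg0]

/-- Right translation by `u₀ ∈ Ū` preserves big-cell support. [folklore] -/
theorem IsBigCell.apply_Ubar {f : SmoothInd P τ} (hf : IsBigCell 𝒟 τ f) {u₀ : G}
    (hu₀ : u₀ ∈ 𝒟.Ubar) : IsBigCell 𝒟 τ (smoothIndRep P τ u₀ f) := by
  intro x hx
  rw [toFun_smoothIndRep_apply] at hx
  obtain ⟨p, hp, u, hu, hpu⟩ := Set.mem_mul.1 (hf _ hx)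
  refine Set.mem_mul.2 ⟨p, hp, u * u₀⁻¹, 𝒟.Ubar.mul_mem hu (𝒟.Ubar.inv_mem hu₀), ?_⟩
  rw [← mul_assoc, hpu, mul_inv_cancel_right]

/-- Right translation by `m ∈ M` preserves big-cell support (`M` normalises `Ū`). [folklore] -/
theorem IsBigCell.apply_M {f : SmoothInd P τ} (hf : IsBigCell 𝒟 τ f) {m : G} (hm : m ∈ 𝒟.M) :
    IsBigCell 𝒟 τ (smoothIndRep P τ m f) := by
  intro x hx
  rw [toFun_smoothIndRep_apply] at hx
  obtain ⟨p, hp, u, hu, hpu⟩ := Set.mem_mul.1 (hf _ hx)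
  -- `x = p u m⁻¹ = (p m⁻¹) (m u m⁻¹)`
  refine Set.mem_mul.2 ⟨p * m⁻¹, P.mul_mem hp (P.inv_mem (𝒟.M_le hm)), m * u * m⁻¹,
    𝒟.conj_mem_Ubar m hm u hu, ?_⟩
  calc p * m⁻¹ * (m * u * m⁻¹) = p * u * m⁻¹ := by group
    _ = x := by rw [hpu, mul_inv_cancel_right]

/-- Values on `Ū` after right translation by `u₀ ∈ Ū`: `(u₀ • f)(u) = f(u u₀)`. [folklore] -/
theorem toFun_apply_Ubar (f : SmoothInd P τ) (u₀ u : G) :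
    (smoothIndRep P τ u₀ f).toFun u = f.toFun (u * u₀) :=
  toFun_smoothIndRep_apply u₀ f u

/-- Values on `Ū` after right translation by `m ∈ M`: `(m • f)(u) = τ(m) f(m⁻¹ u m)`. [folklore] -/
theorem toFun_apply_M (f : SmoothInd P τ) {m : G} (hm : m ∈ 𝒟.M) (u : G) :
    (smoothIndRep P τ m f).toFun u = τ ⟨m, 𝒟.M_le hm⟩ (f.toFun (m⁻¹ * u * m)) := by
  rw [toFun_smoothIndRep_apply, ← f.toFun_subgroup_mul]
  congr 1
  simp [mul_assoc]

end BigCell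

/-! ### The standard functions `φ_{K j, w}` -/

section StdFun

variable {k G W : Type*} [CommRing k] [Group G] [TopologicalSpace G]
  [AddCommGroup W] [Module k W] {P : Subgroup G} (𝒟 : BigCellDatum P) (τ : Representation k P W)

/-- The values allowed at level `j`: vectors fixed by `τ(P ∩ K j)`. [folklore] -/
def fixedByLevel (j : ℕ) : Submodule k W where
  carrier := {w | ∀ p : P, (p : G) ∈ 𝒟.K j → τ p w = w}
  zero_mem' := fun p _ => map_zero _
  add_mem' := fun {a b} ha hb p hp => by rw [map_add, ha p hp, hb p hp]
  smul_mem' := fun c {a} ha p hp => by rw [map_smul, ha p hp]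

/-- Membership in `fixedByLevel`. [folklore] -/
theorem mem_fixedByLevel_iff {j : ℕ} {w : W} :
    w ∈ fixedByLevel 𝒟 τ j ↔ ∀ p : P, (p : G) ∈ 𝒟.K j → τ p w = w := Iff.rfl

/-- The function `φ_{K j, w}` on `G`: `τ(p) w` at `x = p u` with `p ∈ P`, `u ∈ Ū ∩ K j`, and `0`
off `P (Ū ∩ K j)` (well defined by uniqueness of the big-cell decomposition).
(Bernstein–Zelevinsky 1976, §2.21–2.25: the standard generators of an induced representation.)
[folklore] -/
def stdFunAux (j : ℕ) (w : W) : G → W := fun x =>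
  open scoped Classical in
  if h : ∃ p ∈ P, ∃ u ∈ 𝒟.Ubar, u ∈ 𝒟.K j ∧ x = p * u then τ ⟨h.choose, h.choose_spec.1⟩ w else 0

/-- `φ_{K j, w}(p u) = τ(p) w` for `p ∈ P`, `u ∈ Ū ∩ K j`. [folklore] -/
theorem stdFunAux_mul {j : ℕ} (w : W) {p u : G} (hp : p ∈ P) (hu : u ∈ 𝒟.Ubar) (huK : u ∈ 𝒟.K j) :
    stdFunAux 𝒟 τ j w (p * u) = τ ⟨p, hp⟩ w := by
  classical
  have h : ∃ p' ∈ P, ∃ u' ∈ 𝒟.Ubar, u' ∈ 𝒟.K j ∧ p * u = p' * u' := ⟨p, hp, u, hu, huK, rfl⟩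
  rw [stdFunAux, dif_pos h]
  obtain ⟨u', hu', -, hpu⟩ := h.choose_spec.2
  have := (𝒟.eq_of_mul_eq hp h.choose_spec.1 hu hu' hpu).1
  congr 2
  exact Subtype.ext this.symm

/-- `φ_{K j, w}(x) = 0` off `P (Ū ∩ K j)`. [folklore] -/
theorem stdFunAux_eq_zero {j : ℕ} (w : W) {x : G}
    (hx : ¬ ∃ p ∈ P, ∃ u ∈ 𝒟.Ubar, u ∈ 𝒟.K j ∧ x = p * u) : stdFunAux 𝒟 τ j w x = 0 := by
  classical
  rw [stdFunAux, dif_neg hx]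

/-- If `φ_{K j, w}(x) ≠ 0` then `x ∈ P (Ū ∩ K j)`. [folklore] -/
theorem exists_of_stdFunAux_ne_zero {j : ℕ} {w : W} {x : G} (hx : stdFunAux 𝒟 τ j w x ≠ 0) :
    ∃ p ∈ P, ∃ u ∈ 𝒟.Ubar, u ∈ 𝒟.K j ∧ x = p * u := by
  by_contra h
  exact hx (stdFunAux_eq_zero 𝒟 τ w h)

/-- `φ_{K j, w}` on `Ū`: `w` on `Ū ∩ K j`, `0` elsewhere on `Ū`. [folklore] -/
theorem stdFunAux_of_mem_Ubar {j : ℕ} (w : W) {u : G} (hu : u ∈ 𝒟.Ubar) :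
    stdFunAux 𝒟 τ j w u = open scoped Classical in if u ∈ 𝒟.K j then w else 0 := by
  classical
  split_ifs with huK
  · have := stdFunAux_mul 𝒟 τ w P.one_mem hu huK
    rw [one_mul] at this
    rw [this]
    exact congrFun (congrArg DFunLike.coe (show τ ⟨1, P.one_mem⟩ = 1 from map_one τ)) w
  · refine stdFunAux_eq_zero 𝒟 τ w ?_
    rintro ⟨p, hp, u', hu', hu'K, hpu⟩
    obtain ⟨-, rfl⟩ := 𝒟.eq_of_mul_eq P.one_mem hp hu hu' (by rwa [one_mul])
    exact huK hu'K

/-- Left `P`-equivariance of `φ_{K j, w}`: `φ(p x) = τ(p) φ(x)`. [folklore] -/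
theorem stdFunAux_subgroup_mul {j : ℕ} (w : W) (p : P) (x : G) :
    stdFunAux 𝒟 τ j w ((p : G) * x) = τ p (stdFunAux 𝒟 τ j w x) := by
  by_cases hx : ∃ p' ∈ P, ∃ u ∈ 𝒟.Ubar, u ∈ 𝒟.K j ∧ x = p' * u
  · obtain ⟨p', hp', u, hu, huK, rfl⟩ := hx
    rw [← mul_assoc, stdFunAux_mul 𝒟 τ w (P.mul_mem p.2 hp') hu huK,
      stdFunAux_mul 𝒟 τ w hp' hu huK, ← Module.End.mul_apply, ← map_mul]
    rfl
  · rw [stdFunAux_eq_zero 𝒟 τ w hx, map_zero, stdFunAux_eq_zero 𝒟 τ w]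
    rintro ⟨p', hp', u, hu, huK, hpx⟩
    exact hx ⟨(p : G)⁻¹ * p', P.mul_mem (P.inv_mem p.2) hp', u, hu, huK, by
      rw [mul_assoc, ← hpx, inv_mul_cancel_left]⟩

/-- Right `K j`-invariance of `φ_{K j, w}` for `w` fixed by `τ(P ∩ K j)` (uses the Iwahori
factorisation `K j ⊆ (P ∩ K j)(Ū ∩ K j)`). [folklore] -/
theorem stdFunAux_mul_of_mem_K {j : ℕ} {w : W} (hw : w ∈ fixedByLevel 𝒟 τ j) {κ : G}
    (hκ : κ ∈ 𝒟.K j) (x : G) : stdFunAux 𝒟 τ j w (x * κ) = stdFunAux 𝒟 τ j w x := by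
  -- both sides vanish unless `x ∈ P (Ū ∩ K j)`, and `x ∈ P (Ū ∩ K j) ↔ x κ ∈ P (Ū ∩ K j)`
  have key : ∀ {y κ' : G}, κ' ∈ 𝒟.K j → (∃ p ∈ P, ∃ u ∈ 𝒟.Ubar, u ∈ 𝒟.K j ∧ y = p * u) →
      ∃ (p : G) (hp : p ∈ P) (p' : G) (_ : p' ∈ P), p' ∈ 𝒟.K j ∧ ∃ u' ∈ 𝒟.Ubar, u' ∈ 𝒟.K j ∧
        y * κ' = (p * p') * u' ∧ stdFunAux 𝒟 τ j w y = τ ⟨p, hp⟩ w := by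
    intro y κ' hκ' ⟨p, hp, u, hu, huK, hy⟩
    obtain ⟨p', hp'P, hp'K, u', hu', hu'K, huκ⟩ :=
      𝒟.exists_factor j (u * κ') (Subgroup.mul_mem _ huK hκ')
    refine ⟨p, hp, p', hp'P, hp'K, u', hu', hu'K, ?_, ?_⟩
    · rw [hy, mul_assoc, huκ, mul_assoc]
    · rw [hy, stdFunAux_mul 𝒟 τ w hp hu huK]
  by_cases hx : ∃ p ∈ P, ∃ u ∈ 𝒟.Ubar, u ∈ 𝒟.K j ∧ x = p * u
  · obtain ⟨p, hp, p', hp'P, hp'K, u', hu', hu'K, hxκ, hval⟩ := key hκ hx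
    rw [hval, hxκ, stdFunAux_mul 𝒟 τ w (P.mul_mem hp hp'P) hu' hu'K]
    have : τ ⟨p * p', P.mul_mem hp hp'P⟩ = τ ⟨p, hp⟩ * τ ⟨p', hp'P⟩ := by
      rw [← map_mul]; rfl
    rw [this, Module.End.mul_apply, hw ⟨p', hp'P⟩ hp'K]
  · rw [stdFunAux_eq_zero 𝒟 τ w hx, stdFunAux_eq_zero 𝒟 τ w]
    intro hxκ
    obtain ⟨p, hp, p', hp'P, -, u', hu', hu'K, hxκκ, -⟩ := key (Subgroup.inv_mem _ hκ) hxκ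
    rw [mul_inv_cancel_right] at hxκκ
    exact hx ⟨p * p', P.mul_mem hp hp'P, u', hu', hu'K, hxκκ⟩

variable [SeparatelyContinuousMul G]

/-- The **standard vector** `φ_{K j, w} ∈ Ind_P^G τ` attached to a level `j` and a vector `w`
fixed by `τ(P ∩ K j)`: supported on `P (Ū ∩ K j)` with `φ(p u) = τ(p) w`; it is smooth because it
is right `K j`-invariant. (Bernstein–Zelevinsky 1976, §2.21–2.25.) [folklore] -/
def stdFun (j : ℕ) (w : W) (hw : w ∈ fixedByLevel 𝒟 τ j) : SmoothInd P τ :=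
  (⟨⟨stdFunAux 𝒟 τ j w, (mem_indFun_iff P τ _).2 (stdFunAux_subgroup_mul 𝒟 τ w)⟩,
    (indFun P τ).isSmoothVector_of_le (K := 𝒟.K j) (𝒟.isOpen_K j) fun κ hκ => by
      rw [mem_stabilizerSubgroup]
      exact Subtype.ext (funext fun x => stdFunAux_mul_of_mem_K 𝒟 τ hw hκ x)⟩ :
    ↥(smoothInd P τ).toSubmodule)

/-- The underlying function of the standard vector. [folklore] -/
@[simp] theorem toFun_stdFun (j : ℕ) (w : W) (hw : w ∈ fixedByLevel 𝒟 τ j) :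
    (stdFun 𝒟 τ j w hw).toFun = stdFunAux 𝒟 τ j w := rfl

/-- The standard vector is fixed by `K j`. [folklore] -/
theorem stdFun_mem_fixedPoints (j : ℕ) (w : W) (hw : w ∈ fixedByLevel 𝒟 τ j) :
    stdFun 𝒟 τ j w hw ∈ (smoothIndRep P τ).fixedPoints (𝒟.K j) := by
  rw [mem_fixedPoints]
  intro κ hκ
  exact SmoothInd.ext (funext fun x => stdFunAux_mul_of_mem_K 𝒟 τ hw hκ x)

/-- The standard vector is supported on the big cell. [folklore] -/
theorem isBigCell_stdFun (j : ℕ) (w : W) (hw : w ∈ fixedByLevel 𝒟 τ j) :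
    IsBigCell 𝒟 τ (stdFun 𝒟 τ j w hw) := by
  intro x hx
  obtain ⟨p, hp, u, hu, -, rfl⟩ := exists_of_stdFunAux_ne_zero 𝒟 τ hx
  exact Set.mul_mem_mul hp hu

/-- Values of the standard vector on `Ū`. [folklore] -/
theorem toFun_stdFun_of_mem_Ubar (j : ℕ) (w : W) (hw : w ∈ fixedByLevel 𝒟 τ j) {u : G}
    (hu : u ∈ 𝒟.Ubar) :
    (stdFun 𝒟 τ j w hw).toFun u = open scoped Classical in if u ∈ 𝒟.K j then w else 0 :=
  stdFunAux_of_mem_Ubar 𝒟 τ w hu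

/-- The standard vector takes the value `w` at `1`. [folklore] -/
@[simp] theorem toFun_stdFun_one (j : ℕ) (w : W) (hw : w ∈ fixedByLevel 𝒟 τ j) :
    (stdFun 𝒟 τ j w hw).toFun 1 = w := by
  classical
  rw [toFun_stdFun_of_mem_Ubar 𝒟 τ j w hw 𝒟.Ubar.one_mem, if_pos (𝒟.K j).one_mem]

end StdFun

/-! ### Big-cell support is a linear condition -/

section BigCellLinear

variable {k G W : Type*} [CommRing k] [Group G] [TopologicalSpace G] [SeparatelyContinuousMul G]
  [AddCommGroup W] [Module k W] {P : Subgroup G} (𝒟 : BigCellDatum P) (τ : Representation k P W)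

/-- `0` is supported on the big cell. [folklore] -/
theorem isBigCell_zero : IsBigCell 𝒟 τ 0 := fun _ hx => absurd rfl hx

/-- Big-cell support is stable under addition. [folklore] -/
theorem IsBigCell.add {f g : SmoothInd P τ} (hf : IsBigCell 𝒟 τ f) (hg : IsBigCell 𝒟 τ g) :
    IsBigCell 𝒟 τ (f + g) := by
  intro x hx
  rw [SmoothInd.toFun_add, Pi.add_apply] at hx
  by_cases hfx : f.toFun x = 0
  · rw [hfx, zero_add] at hx
    exact hg x hx
  · exact hf x hfx

/-- Big-cell support is stable under scalars. [folklore] -/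
theorem IsBigCell.smul (c : k) {f : SmoothInd P τ} (hf : IsBigCell 𝒟 τ f) :
    IsBigCell 𝒟 τ (c • f) := by
  intro x hx
  rw [SmoothInd.toFun_smul, Pi.smul_apply] at hx
  by_cases hfx : f.toFun x = 0
  · rw [hfx, smul_zero] at hx
    exact absurd rfl hx
  · exact hf x hfx

/-- Big-cell support is stable under finite sums. [folklore] -/
theorem IsBigCell.sum {ι : Type*} (s : Finset ι) {f : ι → SmoothInd P τ}
    (hf : ∀ i ∈ s, IsBigCell 𝒟 τ (f i)) : IsBigCell 𝒟 τ (∑ i ∈ s, f i) := by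
  classical
  induction s using Finset.induction_on with
  | empty => simpa using isBigCell_zero 𝒟 τ
  | insert a s ha ih =>
    rw [Finset.sum_insert ha]
    exact (hf a (Finset.mem_insert_self a s)).add 𝒟 τ
      (ih fun i hi => hf i (Finset.mem_insert_of_mem hi))

/-- Values of a finite sum. [folklore] -/
theorem SmoothInd.toFun_sum {ι : Type*} (s : Finset ι) (f : ι → SmoothInd P τ) (x : G) :
    (∑ i ∈ s, f i).toFun x = ∑ i ∈ s, (f i).toFun x := by
  classical
  induction s using Finset.induction_on with
  | empty => simp [SmoothInd.toFun]; rfl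
  | insert a s ha ih => rw [Finset.sum_insert ha, Finset.sum_insert ha, SmoothInd.toFun_add,
      Pi.add_apply, ih]

end BigCellLinear

end Representation
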